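import Summits.ResolutionOfSingularities.ResolutionOfSingularities.Theorems.PurelyInseparableDim4IsolationStable
import HarnessLib

/-!
# [OURS · res-dim4-pi PR-10, part 8] The colength sequence `d_N = dim_K K[x]/(J_q⁺ + 𝔪₀ᴺ)`: a ONE-SHOT
  certificate (`d_N < N ⇒ isolated`) and the budget bound `N⁺ ≤ μ` («UNDECIDED at NMAX ⇒ non-isolated or
  μ ≥ NMAX»)

Cell `res-dim4-pi` (D-0157 DOOR 2), PR-10 eighth file (seat `res-dim4-p-3`; CLAIM 17:25Z).  Sequel of
`PurelyInseparableDim4IsolationStable.lean` (stationary filtration ⇔ certificate; finite-dimensionality;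
`certificate_of_finrank_eq`).  Write `d_N := finrank_K (K[x₁..x₄] ⧸ (J ⊔ 𝔪₀ᴺ))` for an ideal `J` (for the
census: `J = J_q⁺(F)`).  Then `d_0 = 0`, `d` is non-decreasing, and `d_{N+1} = d_N` exactly at certificate
levels, after which `d` is constant (`= μ`, the colength letter of cards I-3-2 / A-6-x).  Hence:

* `finrank_quotient_sup_pow_zero` (`d_0 = 0`), `finrank_quotient_le_of_le` (`𝔪₀ⁿ ≤ I ≤ I' ⇒ d(I') ≤ d(I)`),
  `finrank_quotient_sup_pow_mono` (`d_N ≤ d_{N+1}`).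
* **`le_finrank_of_forall_not_certificate`**: if NO level `k < N` is a certificate level then `N ≤ d_N`
  (strict increase at every step below `N`).
* **`exists_certificate_of_finrank_lt`** / **`isIsolated_of_finrank_lt`**: ONE measurement `d_N < N` (with
  `J_q⁺(F) ≤ 𝔪₀`) certifies `IsIsolated q F` — no second measurement needed.
* **`certificate_at_finrank`** (`N⁺ ≤ μ`): if `N₀` is any certificate level and `μ := d_{N₀}`, then `μ` itself
  is a certificate level; **`le_finrank_of_forall_not_certificate_of_certificate`**: if no level below `M` is a
  certificate level but some level is, then `M ≤ μ` — the instruments' reading «UNDECIDED at NMAX ⇒ the state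
  is non-isolated OR μ ≥ NMAX» (idea-3 I32_NMAX, p-12's stabilisation protocol) as a theorem.

[OURS · counted 0 · elementary linear algebra; AI kernel work, weaker than expert review.]  Nothing here is a
statement about resolution of singularities; resolution in dimension `≥ 4` / characteristic `p > 0` is NOT
proved by anything in this file.  Host item (DR-157-C): `stmt-ResolutionOfSingularities-16155`, helper.
-/

noncomputable section

set_option linter.dupNamespace false -- mandated namespace of this single-conjunct summit

open MvPolynomial Finset
open scoped BigOperators

namespace Summit.ResolutionOfSingularities.ResolutionOfSingularities.Theorems.PIDim4.IsolationCert

/-! ## §1 The colength sequence: `d_0 = 0`, monotone -/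

/-- `d_0 = 0`: `J ⊔ 𝔪₀⁰ = ⊤`. OURS (bookkeeping). [cite: AtiyahMacdonald1969, Ch. 1 (operations on ideals)] -/
theorem finrank_quotient_sup_pow_zero {K : Type} [Field K] (J : Ideal (MvPolynomial (Fin 4) K)) :
    Module.finrank K (MvPolynomial (Fin 4) K ⧸ (J ⊔ originIdeal K ^ 0)) = 0 := by
  have htop : J ⊔ originIdeal K ^ 0 = ⊤ := by rw [pow_zero, Ideal.one_eq_top, sup_top_eq]
  haveI : Subsingleton (MvPolynomial (Fin 4) K ⧸ (J ⊔ originIdeal K ^ 0)) :=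
    Ideal.Quotient.subsingleton_iff.mpr htop
  exact Module.finrank_zero_of_subsingleton

/-- **Colengths decrease along inclusions**: `𝔪₀ⁿ ≤ I ≤ I' ⇒ finrank_K (A ⧸ I') ≤ finrank_K (A ⧸ I)`
(rank–nullity against the double quotient). OURS (bookkeeping). [cite: AtiyahMacdonald1969, Prop. 6.9 (length is additive)] -/
theorem finrank_quotient_le_of_le {K : Type} [Field K] {I I' : Ideal (MvPolynomial (Fin 4) K)} {n : ℕ}
    (hI : originIdeal K ^ n ≤ I) (hle : I ≤ I') :
    Module.finrank K (MvPolynomial (Fin 4) K ⧸ I') ≤ Module.finrank K (MvPolynomial (Fin 4) K ⧸ I) := by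
  haveI : Module.Finite K (MvPolynomial (Fin 4) K ⧸ I) := moduleFinite_quotient_of_originIdeal_pow_le hI
  set W : Ideal (MvPolynomial (Fin 4) K ⧸ I) := I'.map (Ideal.Quotient.mkₐ K I) with hW
  have hquot : Module.finrank K ((MvPolynomial (Fin 4) K ⧸ I) ⧸ W) =
      Module.finrank K (MvPolynomial (Fin 4) K ⧸ I') :=
    (DoubleQuot.quotQuotEquivQuotOfLEₐ K hle).toLinearEquiv.finrank_eq
  have hrank := Submodule.finrank_quotient (R := K) W
  rw [hquot] at hrank
  omega

/-- **`d_N ≤ d_{N+1}`.** OURS (bookkeeping). [cite: AtiyahMacdonald1969, Prop. 6.9 (length is additive)] -/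
theorem finrank_quotient_sup_pow_mono {K : Type} [Field K] (J : Ideal (MvPolynomial (Fin 4) K)) (N : ℕ) :
    Module.finrank K (MvPolynomial (Fin 4) K ⧸ (J ⊔ originIdeal K ^ N)) ≤
      Module.finrank K (MvPolynomial (Fin 4) K ⧸ (J ⊔ originIdeal K ^ (N + 1))) :=
  finrank_quotient_le_of_le (n := N + 1) le_sup_right
    (sup_le_sup_left (Ideal.pow_le_pow_right (Nat.le_succ N)) J)

/-! ## §2 Strict increase below the first certificate level; the one-shot certificate -/

/-- **No certificate below `N` ⇒ `N ≤ d_N`**: the colength grows by at least one at every non-certificate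
step (`certificate_of_finrank_eq`). OURS (elementary). [cite: AtiyahMacdonald1969, Prop. 6.9 (length is additive)] -/
theorem le_finrank_of_forall_not_certificate {K : Type} [Field K] (J : Ideal (MvPolynomial (Fin 4) K))
    (N : ℕ) (h : ∀ k, k < N → ¬ originIdeal K ^ k ≤ J ⊔ originIdeal K ^ (k + 1)) :
    N ≤ Module.finrank K (MvPolynomial (Fin 4) K ⧸ (J ⊔ originIdeal K ^ N)) := by
  induction N with
  | zero => exact Nat.zero_le _
  | succ N ih =>
    have ih' := ih fun k hk => h k (Nat.lt_succ_of_lt hk)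
    have hmono := finrank_quotient_sup_pow_mono J N
    have hne : Module.finrank K (MvPolynomial (Fin 4) K ⧸ (J ⊔ originIdeal K ^ (N + 1))) ≠
        Module.finrank K (MvPolynomial (Fin 4) K ⧸ (J ⊔ originIdeal K ^ N)) :=
      fun heq => h N (Nat.lt_succ_self N) (certificate_of_finrank_eq heq)
    omega

/-- **`d_N < N` ⇒ some level `k < N` is a certificate level.** OURS (elementary).
[cite: AtiyahMacdonald1969, Prop. 6.9 (length is additive)] -/
theorem exists_certificate_of_finrank_lt {K : Type} [Field K] {J : Ideal (MvPolynomial (Fin 4) K)} {N : ℕ}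
    (h : Module.finrank K (MvPolynomial (Fin 4) K ⧸ (J ⊔ originIdeal K ^ N)) < N) :
    ∃ k, k < N ∧ originIdeal K ^ k ≤ J ⊔ originIdeal K ^ (k + 1) := by
  by_contra hc
  push Not at hc
  exact absurd (le_finrank_of_forall_not_certificate J N hc) (not_le.mpr h)

/-- **THE ONE-SHOT CERTIFICATE**: if `J_q⁺(F) ≤ 𝔪₀` and a SINGLE colength satisfies
`dim_K K[x]/(J_q⁺(F) + 𝔪₀ᴺ) < N`, then the origin is an isolated `q`-fold point. OURS (elementary).
[cite: AtiyahMacdonald1969, Prop. 2.6 / Cor. 2.7 (Nakayama's lemma)] -/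
theorem isIsolated_of_finrank_lt {K : Type} [Field K] {q : ℕ} {F : MvPolynomial (Fin 4) K}
    (hJ : singLocusIdeal q F ≤ originIdeal K) {N : ℕ}
    (h : Module.finrank K (MvPolynomial (Fin 4) K ⧸ (singLocusIdeal q F ⊔ originIdeal K ^ N)) < N) :
    IsIsolated q F := by
  obtain ⟨k, -, hk⟩ := exists_certificate_of_finrank_lt h
  exact isIsolated_of_pow_le_sup_pow_succ hJ hk

/-! ## §3 `N⁺ ≤ μ`: the budget bound -/

/-- **No certificate below `M`, but a certificate at `N₀` ⇒ `M ≤ μ = d_{N₀}`**: the instruments' «UNDECIDED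
at NMAX = M» on an isolated state means `μ ≥ M`. OURS (elementary). [cite: AtiyahMacdonald1969, Prop. 6.9 (length is additive)] -/
theorem le_finrank_of_forall_not_certificate_of_certificate {K : Type} [Field K]
    {J : Ideal (MvPolynomial (Fin 4) K)} {M N₀ : ℕ}
    (hM : ∀ k, k < M → ¬ originIdeal K ^ k ≤ J ⊔ originIdeal K ^ (k + 1))
    (hN₀ : originIdeal K ^ N₀ ≤ J ⊔ originIdeal K ^ (N₀ + 1)) :
    M ≤ Module.finrank K (MvPolynomial (Fin 4) K ⧸ (J ⊔ originIdeal K ^ N₀)) := by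
  classical
  -- the least certificate level `k₀`
  have hex : ∃ k, originIdeal K ^ k ≤ J ⊔ originIdeal K ^ (k + 1) := ⟨N₀, hN₀⟩
  set k₀ := Nat.find hex with hk₀def
  have hk₀ : originIdeal K ^ k₀ ≤ J ⊔ originIdeal K ^ (k₀ + 1) := Nat.find_spec hex
  have hmin : ∀ k, k < k₀ → ¬ originIdeal K ^ k ≤ J ⊔ originIdeal K ^ (k + 1) :=
    fun k hk => Nat.find_min hex hk
  have hk₀N₀ : k₀ ≤ N₀ := Nat.find_min' hex hN₀
  -- `M ≤ k₀ ≤ d_{k₀} = d_{N₀}`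
  have hMk₀ : M ≤ k₀ := by
    by_contra hlt
    exact hM k₀ (not_le.mp hlt) hk₀
  have h1 := le_finrank_of_forall_not_certificate J k₀ hmin
  have h2 := finrank_quotient_eq_of_certificate hk₀ hk₀N₀
  omega

/-- **`N⁺ ≤ μ`: the colength itself is a certificate level.** If `N₀` is any certificate level and
`μ := d_{N₀}` (`= d_N` for every `N ≥ N⁺`), then `𝔪₀^μ ≤ J ⊔ 𝔪₀^(μ+1)`: an isolated state of colength `μ` is
certified after at most `μ` steps. OURS (elementary). [cite: AtiyahMacdonald1969, Prop. 6.9 (length is additive)] -/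
theorem certificate_at_finrank {K : Type} [Field K] {J : Ideal (MvPolynomial (Fin 4) K)} {N₀ : ℕ}
    (hN₀ : originIdeal K ^ N₀ ≤ J ⊔ originIdeal K ^ (N₀ + 1)) :
    originIdeal K ^ (Module.finrank K (MvPolynomial (Fin 4) K ⧸ (J ⊔ originIdeal K ^ N₀))) ≤
      J ⊔ originIdeal K ^ (Module.finrank K (MvPolynomial (Fin 4) K ⧸ (J ⊔ originIdeal K ^ N₀)) + 1) := by
  classical
  have hex : ∃ k, originIdeal K ^ k ≤ J ⊔ originIdeal K ^ (k + 1) := ⟨N₀, hN₀⟩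
  set k₀ := Nat.find hex with hk₀def
  have hk₀ : originIdeal K ^ k₀ ≤ J ⊔ originIdeal K ^ (k₀ + 1) := Nat.find_spec hex
  have hmin : ∀ k, k < k₀ → ¬ originIdeal K ^ k ≤ J ⊔ originIdeal K ^ (k + 1) :=
    fun k hk => Nat.find_min hex hk
  have hle : k₀ ≤ Module.finrank K (MvPolynomial (Fin 4) K ⧸ (J ⊔ originIdeal K ^ N₀)) :=
    le_finrank_of_forall_not_certificate_of_certificate hmin hN₀
  exact certificate_mono hk₀ hle

/-- **Census reading, frame form**: for a state with `J_q⁺(F) ≤ 𝔪₀`, if `d_N < N` at some `N` the state is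
ISOLATED, and then `μ = d_N` is ALREADY the stable value (`d_M = d_N` for all `M ≥ N`). OURS (elementary).
[cite: AtiyahMacdonald1969, Prop. 2.6 / Cor. 2.7 (Nakayama's lemma)] -/
theorem finrank_eq_of_finrank_lt {K : Type} [Field K] {J : Ideal (MvPolynomial (Fin 4) K)} {N : ℕ}
    (h : Module.finrank K (MvPolynomial (Fin 4) K ⧸ (J ⊔ originIdeal K ^ N)) < N) {M : ℕ} (hM : N ≤ M) :
    Module.finrank K (MvPolynomial (Fin 4) K ⧸ (J ⊔ originIdeal K ^ M)) =
      Module.finrank K (MvPolynomial (Fin 4) K ⧸ (J ⊔ originIdeal K ^ N)) := by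
  obtain ⟨k, hk, hcert⟩ := exists_certificate_of_finrank_lt h
  rw [finrank_quotient_eq_of_certificate hcert (hk.le.trans hM),
    finrank_quotient_eq_of_certificate hcert hk.le]

end Summit.ResolutionOfSingularities.ResolutionOfSingularities.Theorems.PIDim4.IsolationCert

end
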